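import Mathlib
import HarnessLib
import Literature.AlgebraicGeometry.Resolution.BlowupsScaling
import Summits.ResolutionOfSingularities.ResolutionOfSingularities.Theorems.WildQuotientsWildQuotientResolutionBlowupExitConeTransferDepthTwo
import Summits.ResolutionOfSingularities.ResolutionOfSingularities.Theorems.WildQuotientsWildQuotientResolutionBlowupLocalExitAffine

/-!
# Lemma C⁺ (presentation form): transporting an ideal with regular blow-up through a presentation of `Γ(O)^G`
(crux stmt-ResolutionOfSingularities-15640 `WildQuotients.WildQuotientResolution`, line `Sketch`; chain w45c
post-V5 programme S2, scaffold F8 of `L/res-L1-w45c-lead-1/S2-DESIGN.md` §4/§5; res-L1-w45c-plan-1 RULING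
2026-08-27T17:31:45Z (2) «transport inside F8». [OURS · L1 W4.5c] — NOT a statement of any manuscript;
replaces the role of no printed item. Lead prover res-L1-w45c-lead-1.)

The NON-RADICAL variant of `BlowupExit.exists_isBlowup_regular_of_invariantsPresentation`: given an equivariant
stable affine piece `O` of `ρ : ActionOver r G`, a presentation `ψ : R → Γ(O)` (injective, range `= Γ(O)^G`), and
ANY ideal `J ⊆ R` whose affine blow-up `Bl_J Spec R` is regular, the ideal sheaf
`𝔞 := (ideal sheaf of J) transported along E : Spec R ≅ O/G` of the quotient piece has a regular blow-up, is
non-zero when `J` is, and its support is the image in `O/G` of the zero locus of any `𝔟 ⊆ Γ(O)` with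
`√(ψ⁻¹(𝔟·Γ(O))) = √J` — the three inputs of lemma G (`BlowupExit.hasResolution_of_isolated_local_blowups`)
for that piece. The S2 scaffold applies it with `R = R₀[1/ν]` (F5 `ConductorOne.presentation`), `J = J₀·R`
(F6 `ConductorOne.toricBrick`, `√J₀ =` irrelevant) and `𝔟 =` the point ideal generators.
-/

-- single-problem summit: the doubled namespace component `ResolutionOfSingularities` is forced
set_option linter.dupNamespace false

noncomputable section

open CategoryTheory AlgebraicGeometry TopologicalSpace
open Literature.AlgebraicGeometry.Resolution Literature.AlgebraicGeometry.RelativeSpec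

namespace Summit.ResolutionOfSingularities.ResolutionOfSingularities.Theorems.WildQuotientResolution.BlowupExit

/-- The support of the ideal sheaf of `J` on `Spec R` is `V(J)`. [folklore] -/
theorem coe_support_idealSheaf {R : Type} [CommRing R] (J : Ideal R) :
    ((affineBlowup.idealSheaf J).support : Set (Spec (CommRingCat.of R))) =
      PrimeSpectrum.zeroLocus (J : Set R) := by
  rw [affineBlowup.idealSheaf, Scheme.IdealSheafData.coe_support_ofIdealTop, Ideal.map, Scheme.zeroLocus_span]
  change (Spec (CommRingCat.of R)).zeroLocus ((Scheme.ΓSpecIso (CommRingCat.of R)).inv '' (J : Set R)) = _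
  rw [Spec_zeroLocus_eq_zeroLocus]

/-- **Lemma C⁺, presentation form.** See the module docstring. [OURS · L1 W4.5c] -/
theorem exists_idealSheaf_of_presentation_ideal {X S : Scheme.{0}} {r : X ⟶ S}
    {G : Type} [Group G] [Finite G] (ρ : ActionOver r G) [S.IsSeparated] [IsSeparated r]
    [IsAffine S] (O : ρ.StableAffineOpens) {R : Type} [CommRing R]
    (ψ : R →+* Γ((O.1 : Scheme.{0}), (O.1.ι ≫ r) ⁻¹ᵁ ⊤)) (hψ : Function.Injective ψ)
    (hrange : ψ.range = (ρ.restrict O.1 O.2.1).invariantsRing ⊤)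
    (J : Ideal R) (hJ0 : J ≠ ⊥) (hreg : Scheme.IsRegular (affineBlowup J))
    (𝔟 : Set Γ((O.1 : Scheme.{0}), (O.1.ι ≫ r) ⁻¹ᵁ ⊤))
    (hJ : ((Ideal.span 𝔟).comap ψ).radical = J.radical) :
    ∃ 𝔞 : (ρ.pieceQuot O).IdealSheafData,
      𝔞 ≠ ⊥ ∧
      (∃ (B : Scheme.{0}) (pB : B ⟶ ρ.pieceQuot O), IsBlowup pB 𝔞 ∧ Scheme.IsRegular B) ∧
      ((𝔞.support : Set (ρ.pieceQuot O)) =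
        (ρ.pieceMk O).base '' ((O.1 : Scheme.{0}).zeroLocus 𝔟)) := by
  obtain ⟨E, hE⟩ := exists_iso_spec_pieceQuot_zeroLocus ρ O ψ hψ hrange
  refine ⟨(affineBlowup.idealSheaf J).comap E.inv, ?_, ?_, ?_⟩
  · -- non-zero: pull back along `E.hom`
    intro h
    have h' := congrArg (fun 𝔞 => Scheme.IdealSheafData.comap 𝔞 E.hom) h
    simp only [← Scheme.IdealSheafData.comap_comp, Iso.hom_inv_id, Scheme.IdealSheafData.comap_id,
      Scheme.IdealSheafData.comap_bot] at h'
    exact affineBlowup.idealSheaf_ne_bot hJ0 h'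
  · -- the blow-up, transported along `E`
    refine exists_isBlowup_regular_of_iso_spec E _ J ?_ hreg
    rw [← Scheme.IdealSheafData.comap_comp, Iso.hom_inv_id, Scheme.IdealSheafData.comap_id]
  · -- the support
    rw [Scheme.IdealSheafData.support_comap, Closeds.coe_preimage, coe_support_idealSheaf]
    have hbij : Function.Bijective E.hom.base :=
      (TopCat.homeoOfIso (Scheme.forgetToTop.mapIso E)).bijective
    -- `E.inv ⁻¹' V(J) = E.hom '' V(J)` and `E.hom '' (E.hom ⁻¹' T) = T`
    have hinv : (E.inv.base : ρ.pieceQuot O → Spec (CommRingCat.of R)) ⁻¹' PrimeSpectrum.zeroLocus (J : Set R) =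
        E.hom.base '' PrimeSpectrum.zeroLocus (J : Set R) := by
      ext y
      constructor
      · intro hy
        refine ⟨E.inv.base y, hy, ?_⟩
        change (E.inv ≫ E.hom).base y = y
        rw [Iso.inv_hom_id]; rfl
      · rintro ⟨x, hx, rfl⟩
        change (E.hom ≫ E.inv).base x ∈ PrimeSpectrum.zeroLocus (J : Set R)
        rw [Iso.hom_inv_id]; exact hx
    rw [hinv, ← PrimeSpectrum.zeroLocus_radical J, ← hJ, PrimeSpectrum.zeroLocus_radical, ← hE 𝔟,
      Set.image_preimage_eq _ hbij.2]

end Summit.ResolutionOfSingularities.ResolutionOfSingularities.Theorems.WildQuotientResolution.BlowupExit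

end
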